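import Literature.MathematicalPhysics.QuantumFieldTheory.Balaban1983to89.B8LeafKnitZd3LettersRDB

/-!
# `Balaban1983to89.B8LeafKnitZd3FourPrinted` — [Balaban1985RegularSpaces] Lemma 1 (p. 79), Theorem 2 (p. 83), Proposition 3 (p. 87), Theorem 4 (p. 88) AS
# PRINTED on the `Ω₀ = ℤᵈ` members of `B8LeafModelZd3.zdGF3` over an index map, FROM [4]'s letters on print's domains and the b9 socket — the FOUR knit
# outputs of `B8LeafKnitZd3LettersRDB.b8LeafRS_zd3_map_lettersRDUB` WITHOUT its Theorem-8 input

statement-level skeleton of published theorems with citation tags; proofs where landed; nothing here is a claim about the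
Yang–Mills mass gap

PDF held: `paper:balaban1985-cmp99-regular-spaces-gauge-fixing` (journal page = PDF page + 74); Lemma 1 p. 79, Thm 2 p. 83, Prop. 3 p. 87, Thm 4 p. 88,
Prop. 5 p. 94; [4] = [Balaban1985BackgroundPropagators] Thm 3.1 p. 397, Thm 3.3 p. 398.

WHY THIS FILE (cell `pub-ymgap`, HUMAN RULING D-0062; R134 acceleration seat `pub-ymgap-dag-n05-d` (g5)).  The packaged knits
(`b8LeafRS_zd3_map_lettersRDUB` → n05-a's `B8LeafKnitZd3E.b8LeafRS_zd3_map_b9allE` → `b8LeafRS_zd3_map_of_thm4`) return the whole surviving leaf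
`B8LeafRS` and therefore DEMAND Theorem 8 surviving over `zdGF3 ∘ ι` as an input `t8` — which is refuted at the members of record
(`B8LeafModelZd3SourceBounded`, `B8LeafModelZd3SourceReality`); the repaired slot `Node00.CarriersB8SubBH.B8LeafOfRecordSubBH` (n05-c g6) is built instead
from the EIGHT old conjuncts and Theorem 8 over the repaired carrier `zdGF3H` (`b8LeafOfRecordSubBH_cutSubB_iff_subB_and_t8H`).  THIS FILE supplies the four
knit outputs among those eight, `t8`-free — **`fourPrinted_zd3_map_lettersRDUB`**: from `SockLettersRD`, the guarded uniqueness letters `SLetUB` and the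
all-levels b9 socket at every `ι j` (members with `Ω 0 = univ` and the laws `hL1`, `hL2lt`, `hL2top`) ⊢ `Lemma1Printed ∧ Thm2Printed ((zdGF3∘ι)·toGFData) ∧
Prop3Printed … ((zdGF3∘ι)·toGFData2) ∧ Thm4Printed (5dLB₀) ((zdGF3∘ι)·toGFData)`.  PROOF = the three packaged proofs composed without the leaf constructor:
`exists_threshold_sockHFP_pairRD`, `exists_threshold_sockP5uEB`, `thm4Printed_zd3_of_HFP₄_mapE` (with `sockH59_of_allLevels`), `thm2Printed_zd3_map_of_thm4`,
`prop3Printed_zd3_map`, `lemma1Printed_blockPairNA` — BY NAME.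

HONEST SCOPE.  Composition only; [4]'s letters and the b9 socket stay HYPOTHESES; nothing of [4], (1.59) or Sect. E is proved here beyond the cited
modules.  Count-neutral; N05 NOT discharged; one finite T⁴ programme at fixed ε; nothing continuum / ℝ⁴ / OS / mass-gap / Clay.  No `sorry`, no `def`,
no `instance`, no `notation`.  Unit `pub-ymgap-dag-n05-d` (g5), 2026-08-27.
-/

noncomputable section

open NormedSpace

namespace Literature.MathematicalPhysics.QuantumFieldTheory.Balaban1983to89.B8LeafKnitZd3FourPrinted

open B7Prop1Explicit B7Prop2Explicit B7Prop1Local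
open B8Ineq132 (InAk BondTouches Under)
open B8Lemma1NonAbelian (mulCfg blockPairNA lemma1Printed_blockPairNA)
open B8Ineq130 (tlo thi)
open B8LeafModelZd (ZdIdx)
open B8LeafModelZdSockP5uE (SockP5uE)
open B8LeafModelZd3 (zdGF3 SockB9P3)
open B8SockLettersRD (SockLettersRD)
open B8SockHFPRD (exists_threshold_sockHFP_pairRD)
open B8SockP5uEAssemblyB (exists_threshold_sockP5uEB)
open B8Ineq132 (covDerivFwd)
open B7Eq78Linearization (zdBlocking QprimeIter)
open B8Eq119TwistedAxial (bgT)
open B8Eq140Level (SideTouches)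
open B8Eq138LandauZd (covLap QT)
open B8Eq1117Concrete (XSpace)
open B8Prop5ContractionKLevel (Bd2)
open B8LambdaSpaceKLevel (wt)
open B8LeafKnitZd3E (thm4Printed_zd3_of_HFP₄_mapE)
open B8LeafModelZd3Map (prop3Printed_zd3_map thm2Printed_zd3_map_of_thm4)
open B8LeafSocketsB9 (sockH59_of_allLevels sockB9P3_of_allLevels)
open QuantumLattice (blockSites)

-- `Site` alone could resolve to the torus sites of `Setup.lean`; re-export the `ℤ^d` sites of `B7Prop1Explicit`.
export B7Prop1Explicit (Site)

variable {d : ℕ}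

section Four

variable {𝔸 : Type} [CStarAlgebra 𝔸] [Nontrivial 𝔸]

/-- **LEMMA 1, THEOREM 2, PROPOSITION 3, THEOREM 4 AS PRINTED OVER AN INDEX MAP, FROM [4]'s LETTERS AND THE b9 SOCKET — WITHOUT A THEOREM-8 INPUT**:
the first four conjuncts of the surviving leaf on `zdGF3 ∘ ι` (`Lemma1Printed` for the block pair; `Thm2Printed`, `Thm4Printed` at `B₁′ = 5dLB₀` over
`·.toGFData`; `Prop3Printed` over `·.toGFData2`), from the existence letters `SockLettersRD`, the guarded uniqueness letters `SLetUB` and the all-levels b9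
socket at every `ι j`.  Hypotheses = `B8LeafKnitZd3LettersRDB.b8LeafRS_zd3_map_lettersRDUB`'s minus the residual members `p5e p5u p6 p7 t8`.
[cite: Balaban1985RegularSpaces, Lemma 1 p.79, Thm 2 p.83, (1.35) p.82, Prop. 3 p.87, Thm 4 p.88, Prop. 5 (1.106)–(1.109) p.94, (1.59) p.86; Balaban1985BackgroundPropagators, Thm 3.1 p.397, Thm 3.3 p.398] -/
theorem fourPrinted_zd3_map_lettersRDUB (hd2 : 2 ≤ d) {L : ℕ} (hL : 2 ≤ L) (Lb : ℕ) (β : ℝ) (len : Site d → ℝ) (inp : B8.B9Inputs)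
    {B₀β C₂ cB9 B₀'H B₂' BG BR cL : ℝ} (hB : 2 ≤ 5 * (d : ℝ) * L * inp.B₀) (hB₀β : 0 < B₀β)
    (hC₂ : 2097152 * ((d : ℝ) + 1) ^ 2 ≤ C₂) (hcB9 : 0 < cB9)
    (hB₀'H : 0 < B₀'H) (hB₂' : 0 ≤ B₂') (hBG : 0 ≤ BG) (hBR : 0 ≤ BR) (hcL : 0 < cL)
    (hfree : 3 * (2 * (d : ℝ) * (L : ℝ) ^ 2) * BG * BR ≤ inp.B₀')
    {J : Type} (ι : J → ZdIdx d L) (hΩ : ∀ j, (ι j).Ω 0 = Set.univ)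
    -- the two member laws the letters route reads, at every member of the map
    (hL1 : ∀ j : J, ∀ m, m ≤ (ι j).k → ∀ n, n ≤ m → ∀ y ∈ (ι j).Λs m n, ∀ x, InBox (tlo L y n) (thi L y n) x → x ∈ (ι j).Ω n)
    (hL2lt : ∀ j : J, ∀ m, m < (ι j).k → ∀ n, n < m → (ι j).Λs m n = (ι j).Λs (m + 1) n)
    (hL2top : ∀ j : J, ∀ m, m < (ι j).k → ∀ x, x ∈ (ι j).Λs m m ↔ x ∈ (ι j).Λs (m + 1) m ∨ ∃ y ∈ (ι j).Λs (m + 1) (m + 1), x ∈ blockSites L y)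
    -- [4]'s letters at every member of the map: existence side (laws on print's domains) and uniqueness side (n04-b's twelve laws at the top structure)
    (SLet : ∀ j : J, SockLettersRD (𝔸 := 𝔸) L BG BR B₀'H B₂' cL (ι j).η (ι j).k (ι j).Ω (ι j).Λs)
    (SLetUB : ∀ j : J, ∀ α₀ : ℝ, 0 < α₀ → α₀ ≤ cL → ∀ U₀ : Site d → Fin d → 𝔸ˣ, (∀ x κ, U₀ x κ ∈ unitaryUnits 𝔸) →
      InAk L (ι j).k (ι j).η α₀ (ι j).Ω U₀ →
      ∃ (g Δ : (Site d → 𝔸) →ₗ[ℂ] (Site d → 𝔸)) (q : (Site d → 𝔸) →ₗ[ℂ] (ℕ → Site d → 𝔸)) (qs : (ℕ → Site d → 𝔸) →ₗ[ℂ] (Site d → 𝔸))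
        (Aw c : (ℕ → Site d → 𝔸) →ₗ[ℂ] (ℕ → Site d → 𝔸)) (H' : XSpace d (ι j).k 𝔸 →ₗ[ℂ] (Site d → 𝔸)),
        (∀ x : Site d → 𝔸, (∃ C : ℝ, ∀ y, ‖x y‖ ≤ C) → g (Δ x + qs (Aw (q x))) = x) ∧ (∀ φ, qs (c (q (g (g (qs φ))))) = qs φ) ∧
        (∀ (f : Site d → 𝔸), ∀ x ∈ (ι j).Ω 0, Δ f x = covLap (ι j).η U₀ (((ι j).Ω 0).indicator f) x) ∧
        (∀ (μ : ℕ → Site d → 𝔸), ∀ x ∈ (ι j).Ω 0, qs μ x = QT L (ι j).k ((ι j).Λs (ι j).k) U₀ μ x) ∧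
        (∀ (f : Site d → 𝔸) (n : ℕ), n ≤ (ι j).k → ∀ y ∈ (ι j).Λs (ι j).k n, q f n y = QprimeIter (zdBlocking d L) (bgT L U₀) n f y) ∧
        (∀ (f : Site d → 𝔸) (n : ℕ) (y : Site d), ¬ (n ≤ (ι j).k ∧ y ∈ (ι j).Λs (ι j).k n) → q f n y = 0) ∧
        (∀ (X : XSpace d (ι j).k 𝔸) (x : Site d), ‖H' X x‖ ≤ B₀'H * ‖X‖) ∧
        (∀ n, n ≤ (ι j).k → ∀ (X : XSpace d (ι j).k 𝔸), ∀ p ∈ {b : Site d × Fin d | SideTouches ((ι j).Ω n) b.1 b.2},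
          wt L (ι j).η n * ‖covDerivFwd (ι j).η U₀ p.2 (H' X) p.1‖ ≤ B₀'H * ‖X‖) ∧
        (∀ X : XSpace d (ι j).k 𝔸, Bd2 L (ι j).η (ι j).k (ι j).Ω (covLap (ι j).η U₀ (H' X)) (B₂' * ‖X‖)) ∧
        (∀ (Y : XSpace d (ι j).k 𝔸) (n : ℕ) (hn : n ≤ (ι j).k) (y : Site d), y ∈ (ι j).Λs (ι j).k n →
          QprimeIter (zdBlocking d L) (bgT L U₀) n (H' Y) y = Y (⟨n, Nat.lt_succ_of_le hn⟩, y)) ∧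
        (∀ (f : Site d → 𝔸) (r : ℝ), 0 ≤ r → Bd2 L (ι j).η (ι j).k (ι j).Ω f r →
          (∀ x, ‖g f x‖ ≤ BG * r) ∧ ∀ n, n ≤ (ι j).k → ∀ p ∈ {b : Site d × Fin d | SideTouches ((ι j).Ω n) b.1 b.2},
            wt L (ι j).η n * ‖covDerivFwd (ι j).η U₀ p.2 (g f) p.1‖ ≤ BG * r) ∧
        (∀ (f : Site d → 𝔸) (r : ℝ), 0 ≤ r → Bd2 L (ι j).η (ι j).k (ι j).Ω f r → Bd2 L (ι j).η (ι j).k (ι j).Ω (f - g (qs (c (q (g f))))) (BR * r)))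
    (SB9all : ∀ j : J, ∀ m, m ≤ (ι j).k → SockB9P3 (𝔸 := 𝔸) L inp.B₀ B₀β cB9 β len (ι j).η m (ι j).Ω (ι j).Λs (ι j).Λb) :
    B8.Lemma1Printed d (blockPairNA d Lb 𝔸) ∧
      B8.Thm2Printed (fun j : J => (zdGF3 𝔸 L β len (ι j)).toGFData) ∧
      B8.Prop3Printed d (L : ℝ) C₂ inp B₀β (fun j : J => (zdGF3 𝔸 L β len (ι j)).toGFData2) ∧
      B8.Thm4Printed (5 * (d : ℝ) * L * inp.B₀) (fun j : J => (zdGF3 𝔸 L β len (ι j)).toGFData) := by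
  have hd1 : 1 ≤ d := le_trans (by norm_num) hd2
  have hLone : 1 ≤ L := le_trans (by norm_num) hL
  have hB₀ := inp.B₀_pos
  have hB₀' := inp.B₀'_pos
  -- the two Proposition-5 sockets below their thresholds, from the letters (n04-b's and this seat's providers BY NAME)
  obtain ⟨cF, hcF, hpair⟩ := exists_threshold_sockHFP_pairRD (𝔸 := 𝔸) hd2 hL inp.B₀_pos inp.B₀'_pos hB hB₀'H hB₂' hBG hBR hcB9 hcL hfree
  obtain ⟨cu, cFu, hcu, hcFu, huniq⟩ := exists_threshold_sockP5uEB (𝔸 := 𝔸) hd2 hL inp.B₀_pos hB hB₀'H hB₂' hBG hBR hcB9 hcL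
  have SHFP₀ := fun j => (hpair (ι j).hη (ι j).hk (ι j).hΩ (ι j).hbox (ι j).hclass (hL1 j) (hL2lt j) (hL2top j) (SLet j) (SB9all j)).1
  have SHFP := fun j => (hpair (ι j).hη (ι j).hk (ι j).hΩ (ι j).hbox (ι j).hclass (hL1 j) (hL2lt j) (hL2top j) (SLet j) (SB9all j)).2
  have SP5u := fun j => huniq (ι j).hη (ι j).hk (ι j).hΩ (hΩ j) (ι j).hbox (ι j).hclass ((hL1 j) (ι j).k le_rfl) (SLetUB j) (SB9all j)
  -- Theorem 4's (1.59) socket below `min cB9 (cB9 / K₀)`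
  have hK₀ : 0 < 2 * (L * (5 * (d : ℝ) * L * inp.B₀)) + 8 * (8 * inp.B₀' * (5 * (d : ℝ) * L * inp.B₀)) := by positivity
  have hc59 : 0 < min cB9 (cB9 / (2 * (L * (5 * (d : ℝ) * L * inp.B₀)) + 8 * (8 * inp.B₀' * (5 * (d : ℝ) * L * inp.B₀)))) :=
    lt_min hcB9 (div_pos hcB9 hK₀)
  have SB9 : ∀ j : J, SockB9P3 (𝔸 := 𝔸) L inp.B₀ B₀β cB9 β len (ι j).η (ι j).k (ι j).Ω (ι j).Λs (ι j).Λb :=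
    fun j => sockB9P3_of_allLevels (SB9all j)
  -- THEOREM 4 printed (n05-a's E knit), then Theorem 2 from Theorem 4, Proposition 3, Lemma 1
  have H4 : B8.Thm4Printed (5 * (d : ℝ) * L * inp.B₀) (fun j : J => (zdGF3 𝔸 L β len (ι j)).toGFData) :=
    thm4Printed_zd3_of_HFP₄_mapE hd2 hL hB₀ hB₀' hB hcu hcF hcF hc59 hcFu ι SHFP₀ SHFP
      (fun j => sockH59_of_allLevels hd1 hLone hB₀ hB₀'.le hcB9 (SB9all j)) SP5u
  exact ⟨lemma1Printed_blockPairNA d Lb 𝔸,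
    thm2Printed_zd3_map_of_thm4 hd2 hL inp.B₀_pos inp.B₀'_pos hB₀β hB ι hΩ H4
      (prop3Printed_zd3_map hd2 hL ⟨inp.B₀, inp.B₀', inp.B₀_pos, inp.B₀'_pos⟩ hB₀β.le le_rfl hcB9 β len ι SB9),
    prop3Printed_zd3_map hd2 hL inp hB₀β.le hC₂ hcB9 β len ι SB9, H4⟩

end Four

#print axioms fourPrinted_zd3_map_lettersRDUB

end Literature.MathematicalPhysics.QuantumFieldTheory.Balaban1983to89.B8LeafKnitZd3FourPrinted

end
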